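import Literature.NumberTheory.GaloisRepresentations.OneCocycleRestrictionKernelCountProofs
import HarnessLib

/-!
# Counting the classes of `H¹(G, X)` whose restriction to a co-generating subgroup lies in a finite set (proofs file)

`Proofs` file (THEOREMS ONLY; no definition, no named fact, no instance, no notation, no `sorry`), sequel of
`OneCocycleRestrictionKernelCountProofs` (the KERNEL count `#{x | x principal on S} ≤ #H⁰(G, X)` for `⟨S, g₀⟩` dense).  Here the
FIBRE form: if the restriction to `S` of a representative is prescribed MODULO `S`-coboundaries within a finite family `(d_i)_{i ∈ ι}` of
functions `S → X`, the classes number at most `#ι · #H⁰(G, X)` — each fibre is a translate of the principal-on-`S` classes.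

Consumer (cell `pub/bsd-print-x9`, shared μ-crux stmt-BirchSwinnertonDyer-23428, clause (B5) `Stmt.readoutIndex` at `v ∣ p`, ANOMALOUS
places): a Selmer class over `K_∞` has graded readout on `Gal(K̄_v/K_{∞,w})` that is principal only MODULO the finite torsion image
`δ(Ẽ(k_{∞,w})[p^∞])` (`#≤ p^{e_v}`, `e_v = 0` iff `v` is non-anomalous), so the relaxed local condition is a finite union of fibres and the
local index picks up the factor `p^{e_v}` — still independent of `m`.

* `natCard_subtype_map_mem_le_mul` — for an additive `φ : A → B`: `#{a | φ a ∈ D} ≤ #D · #ker φ` (`D` finite, `ker φ` finite).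
* **`natCard_setOf_oneCocycleClass_restrict_sub_principal_le`** — `#{x ∈ H¹(G, X) | ∃ rep φ, ∃ i, φ|_S − d_i is an S-coboundary}
  ≤ #ι · #H⁰(G, X)` (and finiteness), under the hypotheses of `finite_and_natCard_setOf_oneCocycleClass_restrict_eq_zero_le`.
* `natCard_setOf_map_oneCocycleClass_mem_le` — pullback form: `#{x | H¹(θ, f) x ∈ D} ≤ #D · #H⁰(G, X)` for a finite set `D` of classes
  of `H¹(H, Y)`, `θ : H → G` onto `S`, `f` bijective.

References: [SerreGaloisCohomology1997] J.-P. Serre, *Galois Cohomology* (1997), Ch. I §2.6(b), §5.1; [Howard2004HeegnerKolyvagin]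
B. Howard, Compositio Math. 140 (2004), Lemma 3.2.7 (arXiv:1202.6340 p. 16 L156–158: the anomalous correction `H⁰(K_v, gr_v A)` ≅
p-power torsion of `Ẽ` over the residue field) and proof of Thm. 2.2.10; [GreenbergLNM1716] §2 (anomalous primes).
BSD is not proved by any of this.
-/

noncomputable section

open TopRep ContRepresentation ContinuousCohomology Topology

namespace Literature.NumberTheory.GaloisRepresentations

universe u v

/-! ## §1 Fibres of an additive map over a finite set -/

/-- **`#{a | φ a ∈ D} ≤ #D · #ker φ`** for an additive map `φ` with finite kernel and a finite set `D` of values: choosing one preimage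
per attained value, `a ↦ (φ a, a − a_{φ a})` embeds the set into `D × ker φ`. [cite: SerreGaloisCohomology1997, Ch. I §5.1 (cosets / torsors: fibres are translates)] -/
theorem natCard_subtype_map_mem_le_mul {A : Type u} {B : Type v} [AddCommGroup A] [AddCommGroup B] (φ : A →+ B) (D : Set B)
    [Finite D] [Finite φ.ker] :
    Finite {a : A // φ a ∈ D} ∧ Nat.card {a : A // φ a ∈ D} ≤ Nat.card D * Nat.card φ.ker := by
  classical
  -- one preimage per attained value
  have hsec : ∀ a : {a : A // φ a ∈ D}, ∃ a₀ : A, φ a₀ = φ a.1 := fun a ↦ ⟨a.1, rfl⟩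
  let base : B → A := fun b ↦ if h : ∃ a₀ : A, φ a₀ = b then h.choose else 0
  have hbase : ∀ a : {a : A // φ a ∈ D}, φ (base (φ a.1)) = φ a.1 := by
    intro a
    have h : ∃ a₀ : A, φ a₀ = φ a.1 := ⟨a.1, rfl⟩
    change φ (if h' : ∃ a₀ : A, φ a₀ = φ a.1 then h'.choose else 0) = φ a.1
    rw [dif_pos h]
    exact h.choose_spec
  let Ψ : {a : A // φ a ∈ D} → D × φ.ker := fun a ↦
    ⟨⟨φ a.1, a.2⟩, ⟨a.1 - base (φ a.1), by rw [AddMonoidHom.mem_ker, map_sub, hbase a, sub_self]⟩⟩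
  have hΨ : Function.Injective Ψ := by
    intro a b hab
    have h1 : φ a.1 = φ b.1 := congrArg (fun z ↦ ((z.1 : D) : B)) hab
    have h2 : a.1 - base (φ a.1) = b.1 - base (φ b.1) := congrArg (fun z ↦ ((z.2 : φ.ker) : A)) hab
    rw [h1] at h2
    exact Subtype.ext (sub_left_injective h2)
  refine ⟨Finite.of_injective Ψ hΨ, ?_⟩
  rw [← Nat.card_prod]
  exact Nat.card_le_card_of_injective Ψ hΨ

/-! ## §2 Classes whose restriction to `S` is prescribed modulo `S`-coboundaries within a finite family -/

variable {R : Type u} [Ring R] [TopologicalSpace R]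
variable {G : Type v} [Group G] [TopologicalSpace G] [IsTopologicalGroup G]
variable {X : TopRep.{v} R G}

/-- **Fibre count.**  `X` finite discrete with continuous orbit maps, `S ≤ G` normalised by `g₀`, `⟨S, g₀⟩` dense; `(d_i)_{i ∈ ι}` a FINITE
family of functions `G → X`.  The classes `x ∈ H¹(G, X)` having a representative `φ` with `φ|_S − d_i|_S` an `S`-COBOUNDARY for some `i`
form a finite set of order `≤ #ι · #H⁰(G, X)`: two classes in the same fibre differ by a class principal on `S`
(`finite_and_natCard_setOf_oneCocycleClass_restrict_eq_zero_le`).  For `G = Γ_{K_v} ⊇ S = Gal(K̄_v/K_{∞,w})` and `X = gr_v T^{(j)}`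
at an ANOMALOUS `v ∣ p`: `d_i` runs over lifts of the torsion classes `δ(Ẽ(k_{∞,w})[p^∞])`.
[cite: SerreGaloisCohomology1997, Ch. I §2.6(b) and §5.1] [cite: Howard2004HeegnerKolyvagin, Lemma 3.2.7 (arXiv:1202.6340 p. 16 L156–158)] -/
theorem natCard_setOf_oneCocycleClass_restrict_sub_principal_le [Finite X] [DiscreteTopology X]
    (hX : ∀ v : X, Continuous fun g : G ↦ X.ρ g v) (S : Subgroup G) (g₀ : G)
    (hnorm : ∀ s ∈ S, g₀⁻¹ * s * g₀ ∈ S) (hdense : Dense ((Subgroup.closure ((S : Set G) ∪ {g₀})) : Set G))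
    {ι : Type*} [Finite ι] (d : ι → G → X) :
    Finite {x : continuousCohomology 1 X // ∃ φ : contOneCocycles X, oneCocycleClass X φ = x ∧
        ∃ i : ι, ∃ v : X, ∀ s ∈ S, φ.1 s - d i s = X.ρ s v - v} ∧
      Nat.card {x : continuousCohomology 1 X // ∃ φ : contOneCocycles X, oneCocycleClass X φ = x ∧
          ∃ i : ι, ∃ v : X, ∀ s ∈ S, φ.1 s - d i s = X.ρ s v - v} ≤
        Nat.card ι * Nat.card {v : X // ∀ g : G, X.ρ g v = v} := by
  classical
  obtain ⟨hPfin, hPle⟩ := finite_and_natCard_setOf_oneCocycleClass_restrict_eq_zero_le hX S g₀ hnorm hdense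
  -- abbreviation: the principal-on-`S` classes
  let P := {x : continuousCohomology 1 X //
    ∃ φ : contOneCocycles X, oneCocycleClass X φ = x ∧ ∃ v : X, ∀ s ∈ S, φ.1 s = X.ρ s v - v}
  haveI : Finite P := hPfin
  -- data of each element: an index and a representative
  let T := {x : continuousCohomology 1 X // ∃ φ : contOneCocycles X, oneCocycleClass X φ = x ∧
    ∃ i : ι, ∃ v : X, ∀ s ∈ S, φ.1 s - d i s = X.ρ s v - v}
  have hdata : ∀ x : T, ∃ (i : ι) (φ : contOneCocycles X) (v : X),
      oneCocycleClass X φ = x.1 ∧ ∀ s ∈ S, φ.1 s - d i s = X.ρ s v - v := by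
    rintro ⟨x, φ, hφ, i, v, hv⟩
    exact ⟨i, φ, v, hφ, hv⟩
  choose idx rep vec hrep hvec using hdata
  -- a base point per attained index
  have hbase : ∀ i : ι, (∃ x : T, idx x = i) → ∃ (φ₀ : contOneCocycles X) (v₀ : X), ∀ s ∈ S, φ₀.1 s - d i s = X.ρ s v₀ - v₀ := by
    rintro i ⟨x, rfl⟩
    exact ⟨rep x, vec x, hvec x⟩
  let φb : ι → contOneCocycles X := fun i ↦ if h : ∃ x : T, idx x = i then (hbase i h).choose else 0
  let vb : ι → X := fun i ↦ if h : ∃ x : T, idx x = i then (hbase i h).choose_spec.choose else 0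
  have hφb : ∀ x : T, ∀ s ∈ S, (φb (idx x)).1 s - d (idx x) s = X.ρ s (vb (idx x)) - vb (idx x) := by
    intro x s hs
    have h : ∃ y : T, idx y = idx x := ⟨x, rfl⟩
    change (if h' : ∃ y : T, idx y = idx x then (hbase _ h').choose else 0).1 s - d (idx x) s =
      X.ρ s (if h' : ∃ y : T, idx y = idx x then (hbase _ h').choose_spec.choose else 0) -
        (if h' : ∃ y : T, idx y = idx x then (hbase _ h').choose_spec.choose else 0)
    rw [dif_pos h, dif_pos h]
    exact (hbase _ h).choose_spec.choose_spec s hs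
  -- the embedding `x ↦ (idx x, x − base)` into `ι × P`
  let Ψ : T → ι × P := fun x ↦ ⟨idx x, ⟨x.1 - oneCocycleClass X (φb (idx x)),
    ⟨rep x - φb (idx x), by rw [oneCocycleClass_sub, hrep], vec x - vb (idx x), fun s hs ↦ by
      change (rep x).1 s - (φb (idx x)).1 s = X.ρ s (vec x - vb (idx x)) - (vec x - vb (idx x))
      have h1 := hvec x s hs
      have h2 := hφb x s hs
      rw [map_sub]
      have e : (rep x).1 s - (φb (idx x)).1 s = ((rep x).1 s - d (idx x) s) - ((φb (idx x)).1 s - d (idx x) s) := by abel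
      rw [e, h1, h2]
      abel⟩⟩⟩
  have hΨ : Function.Injective Ψ := by
    intro x y hxy
    have h1 : idx x = idx y := congrArg Prod.fst hxy
    have h2 : x.1 - oneCocycleClass X (φb (idx x)) = y.1 - oneCocycleClass X (φb (idx y)) :=
      congrArg (fun z ↦ ((z.2 : P) : continuousCohomology 1 X)) hxy
    rw [h1] at h2
    exact Subtype.ext (sub_left_injective h2)
  refine ⟨Finite.of_injective Ψ hΨ, ?_⟩
  calc Nat.card T ≤ Nat.card (ι × P) := Nat.card_le_card_of_injective Ψ hΨ
    _ = Nat.card ι * Nat.card P := Nat.card_prod ι P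
    _ ≤ Nat.card ι * Nat.card {v : X // ∀ g : G, X.ρ g v = v} := Nat.mul_le_mul_left _ hPle

/-! ## §3 Pullback form: restriction landing in a finite set of classes -/

variable {H : Type v} [Group H] [TopologicalSpace H] [IsTopologicalGroup H] {Y : TopRep.{v} R H}

/-- **`#{x ∈ H¹(G, X) | H¹(θ, f) x ∈ D} ≤ #D · #H⁰(G, X)`** for a FINITE set `D` of classes of `H¹(H, Y)`, the restriction along
`θ : H → G` onto `S` (normalised by `g₀`, `⟨S, g₀⟩` dense) with `f` bijective, `X` finite discrete with continuous orbit maps: the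
fibres over `D` are translates of the kernel (`natCard_setOf_map_oneCocycleClass_eq_zero_le`).
[cite: SerreGaloisCohomology1997, Ch. I §2.6(b)] [cite: Howard2004HeegnerKolyvagin, Lemma 3.2.7 (arXiv:1202.6340 p. 16 L156–158)] -/
theorem natCard_setOf_map_oneCocycleClass_mem_le [Finite X] [DiscreteTopology X]
    (hX : ∀ v : X, Continuous fun g : G ↦ X.ρ g v) (S : Subgroup G) (g₀ : G)
    (hnorm : ∀ s ∈ S, g₀⁻¹ * s * g₀ ∈ S) (hdense : Dense ((Subgroup.closure ((S : Set G) ∪ {g₀})) : Set G))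
    (θ : H →ₜ* G) (f : res (θ : H →* G) X ⟶ Y) (hf : Function.Bijective f.hom) (hSθ : ∀ s ∈ S, ∃ h, θ h = s)
    (D : Set (continuousCohomology 1 Y)) [Finite D] :
    Finite {x : continuousCohomology 1 X // ContinuousCohomology.map θ f 1 x ∈ D} ∧
      Nat.card {x : continuousCohomology 1 X // ContinuousCohomology.map θ f 1 x ∈ D} ≤
        Nat.card D * Nat.card {v : X // ∀ g : G, X.ρ g v = v} := by
  classical
  obtain ⟨hKfin, hKle⟩ := natCard_setOf_map_oneCocycleClass_eq_zero_le hX S g₀ hnorm hdense θ f hf hSθ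
  let φ : continuousCohomology 1 X →+ continuousCohomology 1 Y := (ContinuousCohomology.map θ f 1).hom.toAddMonoidHom
  have hφ : ∀ x, φ x = ContinuousCohomology.map θ f 1 x := fun _ ↦ rfl
  -- the kernel of `φ` is the set counted in the kernel form
  have hker : Nat.card φ.ker = Nat.card {x : continuousCohomology 1 X // ContinuousCohomology.map θ f 1 x = 0} :=
    Nat.card_congr (Equiv.subtypeEquivRight fun x ↦ by rw [AddMonoidHom.mem_ker, hφ])
  haveI : Finite {x : continuousCohomology 1 X // ContinuousCohomology.map θ f 1 x = 0} := hKfin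
  haveI : Finite φ.ker :=
    Finite.of_equiv _ (Equiv.subtypeEquivRight fun x ↦ by rw [AddMonoidHom.mem_ker, hφ]).symm
  obtain ⟨hfin, hle⟩ := natCard_subtype_map_mem_le_mul φ D
  refine ⟨hfin, hle.trans ?_⟩
  rw [hker]
  exact Nat.mul_le_mul_left _ hKle

end Literature.NumberTheory.GaloisRepresentations
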